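import Summits.HodgeConjecture.HodgeConjecture.Theorems.F3DualAbelianSchemeMcN3Tower
import HarnessLib

/-!
# F-3 (M) grandchild line `Cruxes/HDel/Lines/F3DualAbelianSchemeMc` — the letter (N3′) `stub_McN3` PROVED
# («every `Spec 𝒪_{T′,t}⁄𝔪^{n+1} → T′` factors through the seesaw graph `Γ`», [MumfordAV1970] §13, the Artinian tower)

Cell `hodgecm-mathlib` (D-0151 ∕ D-0183 FLOOR 0), programme P1, sub-line F-3, child (M), grandchild line
`Cruxes/HDel/Lines/F3DualAbelianSchemeMc.lean` (v2.1c fd89bfcd), node **N3′** (:367) = the head `stub_McN3_holds` of the great-grandchild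
line `Cruxes/HDel/Lines/F3DualAbelianSchemeMcN3.lean` (v1.4 73a66a1c).  HC_CM is proved only modulo the 7 printed citations until rung 0
closes; nothing in this file is about HC.

`stub_McN3_holds` restates the tree letter `Summit.HodgeConjecture.CorCM.Cruxes.HypDel.F3DualAbelianSchemeMc.stub_McN3` TOKEN FOR TOKEN
and proves it (G4) over ★ `Theorems/F3DualAbelianSchemeMcN3Tower` (`N3.graphPoint_tower` = G3, `N3.graphPoints_injective` = N2b′ with
the signed `(hL)` reshape discharging S-f's `hinj`): `𝒪_{T′,t}⁄𝔪^{n+1}` is Artinian local (`T′` locally Noetherian: locally of finite type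
over the finite étale `S′` over the Noetherian `R`), `char κ(t) = 0` (`ℚ → R → κ(t)`), the tower at `K := 𝔪^{n+1}`, and the graph's functor
of points `hΓ` turns the graph point into the factorisation.  Custody F0P1c-p02 (g0); lead B-p02 (g17) route (a) 2026-08-30T23:02:57Z;
then (Mc) v2.2 discharges `stub_McN3` by name with `import Summits.HodgeConjecture.HodgeConjecture.Theorems.F3DualAbelianSchemeMcStubN3`.

## References
* [MumfordAV1970] D. Mumford, *Abelian Varieties* (1970), §13 (Thm. p. 125 and its proof, pp. 125–130).
* [Hartshorne2010] R. Hartshorne, *Deformation Theory* (2010), §6 (6.1) (p. 46), Thm. 6.4 (pp. 50–51).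
* [StacksProject] The Stacks Project, Tag 00J8.
-/

noncomputable section

open CategoryTheory CategoryTheory.Limits AlgebraicGeometry MonoidalCategory CartesianMonoidalCategory
open scoped MonObj
open Literature.AlgebraicGeometry Literature.AlgebraicGeometry.AbelianSchemes
open Literature.AlgebraicGeometry.Motives Literature.AlgebraicGeometry.AbelianVarieties Literature.AlgebraicGeometry.Modules
open Literature.AlgebraicGeometry.Deformation

namespace Summit.HodgeConjecture.CorCM.Cruxes.HypDel.F3DualAbelianSchemeMc

/-- **(N3′) `stub_McN3` PROVED from the inner stubs S-a/S-b/S-e (S-d inside S-e), S-f and the sibling N2b′** — the statement is the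
(Mc) line's `stub_McN3` (v2.1c :367) VERBATIM: for every point `t` of the affine finite-type `T′ → S′` and every `n`, the infinitesimal
neighbourhood `Spec 𝒪_{T′,t}⁄𝔪^{n+1} → T′` factors through the seesaw graph `Γ`.  Proof: `T′` is locally Noetherian (finite type over the
finite étale `S′` over the Noetherian `R`), so `𝒪_{T′,t}⁄𝔪^{n+1}` is Artinian local; `char κ(t) = 0` (`ℚ → R → κ(t)`); N2b′ in the `lift x y`
spelling gives `hinj`; the tower (G3) at `K := 𝔪^{n+1}`, `ψ := mk` gives a graph point `y`, and the graph's functor of points `hΓ` at the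
test object `Spec 𝒪_{T′,t}⁄𝔪^{n+1} → S′` turns `(x, y)` into the factorisation. [cite: MumfordAV1970, §13 (Thm. p. 125 and its proof, pp. 125–130)]
[cite: Hartshorne1977, Ch. II, Prop. 5.9 (p. 116)] -/
theorem stub_McN3_holds : ∀ (R : Type) [CommRing R] [IsNoetherianRing R] [Algebra ℚ R] (A : AbelianSchemeOver (Spec (.of R)))
    (L : A.left.Modules) (hL : HasRank L 1)
    (_hε : CechPic.pullback A.unitSection (detClass (HasRank.isFiniteLocallyFree' hL)) = 1)
    (_hΘ : ∀ ⦃Ω : Type⦄ [Field Ω] [IsAlgClosed Ω] (s : Spec (.of Ω) ⟶ Spec (.of R)),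
      ∃ Θ : CartierDivisor (A.fibre s).toAbelianVariety.X.left, Θ.IsAmple ∧
        CechPic.pullback (X := (A.fibre s).toAbelianVariety.X.left) (pullback.fst A.X.hom s)
          (detClass (HasRank.isFiniteLocallyFree' hL)) = Θ.cechClass)
    {S' : Scheme.{0}} [IsAffine S'] (p : S' ⟶ Spec (.of R)) [IsFinite p] [Etale p] [Surjective p]
    (hat : AbelianSchemeOver S') (π : (A.baseChange p).X ⟶ hat.X) [IsMonHom π]
    (_hπ : IsFinite π.left ∧ Etale π.left ∧ Surjective π.left)
    (P : ((A.baseChange p).prodLeft hat).Modules)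
    (_hker : ∀ (T : Over S') (u : T ⟶ (A.baseChange p).X),
      u ≫ π = 1 ↔ (A.baseChange p).MemKOfL ((Scheme.Modules.pullback (pullback.fst A.X.hom p)).obj L) u)
    (_h1 : HasRank P 1)
    (_hrig : Nonempty ((Scheme.Modules.pullback ((A.baseChange p).unitSlice hat)).obj P ≅ SheafOfModules.unit _))
    (_hsock : Nonempty ((Scheme.Modules.pullback ((A.baseChange p).X ◁ π).left).obj P ≅
      (A.baseChange p).mumfordBundle ((Scheme.Modules.pullback (pullback.fst A.X.hom p)).obj L)))
    (T' : Over S') [IsAffine T'.left] [LocallyOfFiniteType T'.hom]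
    (ℒ : (A.baseChange p).RigidifiedLineBundle T'.hom) (_hℒ : ℒ.FibrewisePicZero)
    (Γ : Over S') (i : Γ ⟶ T' ⊗ hat.X) [IsClosedImmersion i.left],
    (∀ (S : Over S') (u : S ⟶ T' ⊗ hat.X), (∃ v : S ⟶ Γ, v ≫ i = u) ↔
      Nonempty ((Scheme.Modules.pullback ((A.baseChange p).baseChangeToProd hat S.hom
          (u ≫ CartesianMonoidalCategory.snd T' hat.X).left (Over.w (u ≫ CartesianMonoidalCategory.snd T' hat.X)))).obj P ≅
        (Scheme.Modules.pullback ((A.baseChange p).X ◁ (u ≫ CartesianMonoidalCategory.fst T' hat.X)).left).obj ℒ.L)) →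
    ∀ (t : T'.left) (n : ℕ),
      ∃ g : Spec (.of (↑(T'.left.presheaf.stalk t) ⧸
          IsLocalRing.maximalIdeal ↑(T'.left.presheaf.stalk t) ^ (n + 1))) ⟶ Γ.left,
        g ≫ (i ≫ CartesianMonoidalCategory.fst T' hat.X).left =
          Spec.map (CommRingCat.ofHom (Ideal.Quotient.mk
            (IsLocalRing.maximalIdeal ↑(T'.left.presheaf.stalk t) ^ (n + 1)))) ≫ T'.left.fromSpecStalk t := by
  intro R _ _ _ A L hL hε hΘ S' _ p _ _ _ hat π _ hπ P hker h1 hrig hsock T' _ _ ℒ hℒ Γ i _ hΓ t n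
  classical
  -- `T′` is locally Noetherian
  haveI : IsLocallyNoetherian S' := LocallyOfFiniteType.isLocallyNoetherian p
  haveI : IsLocallyNoetherian T'.left := LocallyOfFiniteType.isLocallyNoetherian T'.hom
  -- `char κ(t) = 0`
  haveI : CharZero (T'.left.residueField t) := by
    have φ₁ : R →+* (Γ(T'.left, ⊤) : Type) :=
      ((T'.hom ≫ p).appTop).hom.comp (Scheme.ΓSpecIso (.of R)).inv.hom
    have φ₂ : (Γ(T'.left, ⊤) : Type) →+* (T'.left.residueField t : Type) :=
      (T'.left.presheaf.germ ⊤ t (TopologicalSpace.Opens.mem_top t) ≫ T'.left.residue t).hom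
    exact charZero_of_injective_ringHom ((φ₂.comp φ₁).comp (algebraMap ℚ R)).injective
  -- N2b′ ⇒ uniqueness of graph points over geometric points
  have hinj : ∀ ⦃Ω : Type⦄ [Field Ω] [IsAlgClosed Ω] (s : Spec (.of Ω) ⟶ S') (x : Over.mk s ⟶ T')
      (y y' : Over.mk s ⟶ hat.X),
      Nonempty ((Scheme.Modules.pullback ((A.baseChange p).baseChangeToProd hat s y.left (Over.w y))).obj P ≅
        (Scheme.Modules.pullback ((A.baseChange p).X ◁ x).left).obj ℒ.L) →
      Nonempty ((Scheme.Modules.pullback ((A.baseChange p).baseChangeToProd hat s y'.left (Over.w y'))).obj P ≅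
        (Scheme.Modules.pullback ((A.baseChange p).X ◁ x).left).obj ℒ.L) → y = y' := by
    intro Ω _ _ s x y y' hy hy'
    have h := N3.graphPoints_injective R A L hL p hat π hπ P hker h1 hsock T' ℒ hℒ s (CartesianMonoidalCategory.lift x y)
      (CartesianMonoidalCategory.lift x y')
      (by rw [CartesianMonoidalCategory.lift_fst, CartesianMonoidalCategory.lift_fst])
    rw [CartesianMonoidalCategory.lift_snd, CartesianMonoidalCategory.lift_snd, CartesianMonoidalCategory.lift_fst,
      CartesianMonoidalCategory.lift_fst] at h
    exact h hy hy'
  -- `O := 𝒪_{T′,t} ⁄ 𝔪^{n+1}` is Artinian local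
  haveI := N3.isArtinianRing_quotient_maximalIdeal_pow' (R₀ := (T'.left.presheaf.stalk t : Type)) n
  haveI := N3.isLocalRing_quotient_maximalIdeal_pow' (R₀ := (T'.left.presheaf.stalk t : Type)) n
  -- the tower at `K := 𝔪^{n+1}`, `ψ := mk`
  obtain ⟨y, ⟨e⟩⟩ := N3.graphPoint_tower R A L hL hε hΘ p hat π hπ P hker h1 hrig hsock T' ℒ hℒ hinj t _
    (↑(T'.left.presheaf.stalk t) ⧸ IsLocalRing.maximalIdeal ↑(T'.left.presheaf.stalk t) ^ (n + 1))
    (Ideal.Quotient.mk _) Ideal.Quotient.mk_surjective Ideal.mk_ker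
    ((Spec.map (CommRingCat.ofHom (Ideal.Quotient.mk
        (IsLocalRing.maximalIdeal ↑(T'.left.presheaf.stalk t) ^ (n + 1)))) ≫ T'.left.fromSpecStalk t) ≫ T'.hom)
    (Over.homMk (Spec.map (CommRingCat.ofHom (Ideal.Quotient.mk
        (IsLocalRing.maximalIdeal ↑(T'.left.presheaf.stalk t) ^ (n + 1)))) ≫ T'.left.fromSpecStalk t) rfl) rfl
  -- the graph's functor of points at the test object `Spec O → S′`
  obtain ⟨v, hv⟩ := (hΓ (Over.mk _) (CartesianMonoidalCategory.lift (Over.homMk (Spec.map (CommRingCat.ofHom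
      (Ideal.Quotient.mk (IsLocalRing.maximalIdeal ↑(T'.left.presheaf.stalk t) ^ (n + 1)))) ≫
        T'.left.fromSpecStalk t) rfl) y)).mpr (by
    rw [CartesianMonoidalCategory.lift_snd, CartesianMonoidalCategory.lift_fst]
    exact ⟨e⟩)
  refine ⟨v.left, ?_⟩
  change (v ≫ i ≫ CartesianMonoidalCategory.fst T' hat.X).left = _
  rw [← Category.assoc, hv, CartesianMonoidalCategory.lift_fst]
  rfl

end Summit.HodgeConjecture.CorCM.Cruxes.HypDel.F3DualAbelianSchemeMc

end
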